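import Summits.QuantumAdvantage.QuantumAdvantage.Theorems.WalkThreeStepThreeWeightsFar
import Summits.QuantumAdvantage.QuantumAdvantage.Theorems.WalkThreeStepRigidLoss
import Summits.QuantumAdvantage.QuantumAdvantage.Theorems.WalkFiniteStateRungEquidist

/-!
# Rung (G♯₂) `ThreeStepFreeRungFive` (item stmt-QuantumAdvantage-23286), architecture (U): RIGID LOSS FROM (SYM) + (NEAR)

Cell qa-qnc0, route OddPrimeWalk, support item stmt-QuantumAdvantage-23286; prover qn-prover-3 g16.

The fibre count of `WalkThreeStepRigidLoss` (module U-e′) re-derived from the weaker hypotheses of `WalkThreeStepThreeWeightsFar`: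
(SYM) `RegSym S a L` (the register is invariant under the inner transpositions — unconditional on hub-free degenerate intervals,
`reg_cornerFlip_free`) and (NEAR) `NearReads S R a L` (effective reads landing strictly inside the interval are within `R` of the cut —
the conclusion of the far-read lemma U-c1).  Results: `win_place_eq_far`, `win_fillBlock_mod_far`, `card_winRes_le_far`,
`card_win_fibre_le_far`, and the ε-form **`rigid_loss_far`**: for every `ε > 0`, `R` there is `L₀` such that an interval of length
`L ≥ L₀` with (SYM) and (NEAR) (`a + L ≤ n`) wins on at most `(2/3 + ε)·2^L` patterns of every fibre.  So the assembly of (U) now needs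
exactly: hubs (U-b ✓), usable bound (U-a ✓), `reg_cornerFlip_free` (✓), the far-read lemma U-c1 (OPEN) and this file.
WHAT THIS IS NOT: not the item; separation NOT moved.
-/

namespace Summit.QuantumAdvantage.AdviceFreeQNC0.LocalEngine

open Finset Classical

namespace RungU

variable {p n : ℕ}

/-! ### §1 WIN depends only on the weight; reduction mod `3p` (from (SYM) + (NEAR)) -/

section Rigid

variable (hp : 1 ≤ p) (hp3 : p % 3 ≠ 0) (c : ℕ) (S : ThreeStep p n) {a L R : ℕ}
  (hsym : RegSym S a L) (hnear : NearReads S R a L) (hn : a + L ≤ n)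
include hp hp3 hsym hnear hn

/-- **WIN of a placed pattern is WIN of the block of the same weight.** -/
theorem win_place_eq_far (u : Fin n → Bool) (P : Fin L → Bool) :
    ringWinU c S.y (place u a L P) = ringWinU c S.y (fillBlock u a L 0 (wt P)) := by
  have hLn : a + L ≤ n := hn
  have hwt : wt P ≤ L := by
    unfold wt
    have := Finset.card_filter_le (univ : Finset (Fin L)) (fun i => P i = true)
    rwa [Finset.card_univ, Fintype.card_fin] at this
  have _ := hp; have _ := hp3; have _ := hnear
  apply swap_connect (fun x => ringWinU c S.y x) a (a + L)
    (fun k h1 h2 y => by rw [Bool.eq_iff_iff, ringWinU_iff_ev, ringWinU_iff_ev, hsym k (by omega) h2 y, wt_cornerFlip])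
  · intro i hi
    rw [place_outside u P i (by omega), fillBlock_outside u i (by omega)]
  · rw [cnt_place u hLn, cnt_fillBlock_zero u hwt hLn]

omit hp hp3 hsym hnear hn in
/-- a `q`-periodic Boolean function (below a ceiling) only depends on the argument mod `q`. -/
theorem periodic_mod (f : ℕ → Bool) (q e B : ℕ) (hq : 0 < q) (hper : ∀ w, w + q + e ≤ B → f (w + q) = f w) :
    ∀ w, w + e ≤ B → f w = f (w % q) := by
  intro w
  induction w using Nat.strong_induction_on with
  | _ w ih =>
    intro hw
    by_cases hlt : w < q
    · rw [Nat.mod_eq_of_lt hlt]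
    · push Not at hlt
      have e1 : w = (w - q) + q := by omega
      have h1 := hper (w - q) (by omega)
      rw [← e1] at h1
      rw [h1, ih (w - q) (by omega) (by omega), Nat.mod_eq_sub_mod hlt]

/-- **reduction mod `3p`** (from (SYM) + (NEAR)): for weights with room above, WIN of the block only depends on the weight mod `3p`. -/
theorem win_fillBlock_mod_far (u : Fin n → Bool) (w : ℕ) (hw : w + (p + 2 * R) ≤ L) :
    ringWinU c S.y (fillBlock u a L 0 w) = ringWinU c S.y (fillBlock u a L 0 (w % (3 * p))) :=
  periodic_mod (fun w => ringWinU c S.y (fillBlock u a L 0 w)) (3 * p) (p + 2 * R) L (by omega)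
    (fun w hw => win_fillBlock_period_far hp hp3 c S hsym hnear hn (C := 0) (v := w) (by omega) u) w hw

/-! ### §2 At most `2p` winning residues; the tail -/

omit hp hp3 hsym hnear hn in
/-- a Boolean function on `[0, 3q)` with no true triple `{j, j+q, j+2q}` is true at most `2q` times. -/
theorem card_filter_range_three (f : ℕ → Bool) (q : ℕ)
    (h : ∀ j, j < q → ¬ (f j = true ∧ f (j + q) = true ∧ f (j + 2 * q) = true)) :
    ((range (3 * q)).filter fun r => f r = true).card ≤ 2 * q := by
  set g : ℕ → ℕ := fun r => (f r).toNat with hg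
  have hsum : ((range (3 * q)).filter fun r => f r = true).card = ∑ r ∈ range (3 * q), g r := by
    rw [Finset.card_filter]
    apply Finset.sum_congr rfl
    intro r _
    simp only [hg]
    cases f r <;> simp
  rw [hsum, show 3 * q = q + q + q by ring, Finset.sum_range_add, Finset.sum_range_add, ← Finset.sum_add_distrib,
    ← Finset.sum_add_distrib]
  have key : ∀ b1 b2 b3 : Bool, ¬ (b1 = true ∧ b2 = true ∧ b3 = true) → b1.toNat + b2.toNat + b3.toNat ≤ 2 := by decide
  have hle : ∀ j ∈ range q, g j + g (q + j) + g (q + q + j) ≤ 2 := by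
    intro j hj
    rw [Finset.mem_range] at hj
    simp only [hg]
    rw [show q + j = j + q by ring, show q + q + j = j + 2 * q by ring]
    exact key _ _ _ (h j hj)
  calc ∑ j ∈ range q, (g j + g (q + j) + g (q + q + j)) ≤ ∑ j ∈ range q, 2 := Finset.sum_le_sum hle
    _ = 2 * q := by rw [Finset.sum_const, Finset.card_range, smul_eq_mul, mul_comm]

/-! ### §3 The fibre count -/

/-- **A RIGID INTERVAL WINS AT MOST `2/3 + o(1)` OF ITS FIBRE** (explicit form): for any equidistribution rate `ρ ≥ 0` of the
binomial mod `3p` in dimension `L`. -/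
theorem card_win_fibre_le_far (hL : 4 * p + 2 * R ≤ L) (ρ : ℝ) (hρ0 : 0 ≤ ρ)
    (hρ : ∀ t : ZMod (3 * p),
      |((((univ : Finset (Fin L → Bool)).filter fun v => ((wt v : ℕ) : ZMod (3 * p)) = t).card : ℕ) : ℝ) - (2 : ℝ) ^ L / (3 * p)|
        ≤ ρ ^ L * (2 : ℝ) ^ L)
    (u : Fin n → Bool) :
    ((((univ : Finset (Fin L → Bool)).filter fun P => ringWinU c S.y (place u a L P) = true).card : ℕ) : ℝ)
      ≤ 2 / 3 * (2 : ℝ) ^ L + 2 * p * (ρ ^ L * (2 : ℝ) ^ L) + ((p + 2 * R) * (L + 1) ^ (p + 2 * R) : ℕ) := by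
  set K := p + 2 * R with hK
  set f : ℕ → Bool := fun r => ringWinU c S.y (fillBlock u a L 0 r) with hf
  set Wn : Finset (Fin L → Bool) := univ.filter fun P => ringWinU c S.y (place u a L P) = true with hWn
  set T : Finset (Fin L → Bool) := univ.filter fun P => L < wt P + K with hT
  set Fil : Finset ℕ := (range (3 * p)).filter fun r => f r = true with hFil
  set cls : ℕ → Finset (Fin L → Bool) := fun r => univ.filter fun P => ((wt P : ℕ) : ZMod (3 * p)) = (r : ZMod (3 * p)) with hcls
  have h3p : 0 < 3 * p := by omega
  -- cover
  have hsub : Wn ⊆ T ∪ Fil.biUnion cls := by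
    intro P hP
    rw [hWn, Finset.mem_filter] at hP
    rw [Finset.mem_union]
    by_cases ht : L < wt P + K
    · left; rw [hT, Finset.mem_filter]; exact ⟨Finset.mem_univ _, ht⟩
    · right
      rw [Finset.mem_biUnion]
      refine ⟨wt P % (3 * p), ?_, ?_⟩
      · rw [hFil, Finset.mem_filter, Finset.mem_range]
        refine ⟨Nat.mod_lt _ h3p, ?_⟩
        rw [hf]
        simp only
        rw [← win_fillBlock_mod_far hp hp3 c S hsym hnear hn u (wt P) (by omega), ← win_place_eq_far hp hp3 c S hsym hnear hn u P]
        exact hP.2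
      · rw [hcls, Finset.mem_filter]
        refine ⟨Finset.mem_univ _, ?_⟩
        rw [ZMod.natCast_eq_natCast_iff']
        exact (Nat.mod_mod _ _).symm
  have hFil : Fil.card ≤ 2 * p :=
    card_filter_range_three (fun r => ringWinU c S.y (fillBlock u a L 0 r)) p
      (fun j hj => threeWeights_law_far hp hp3 c S hsym hnear hn (C := 0) (v := j) (by omega) u)
  have hT : T.card ≤ K * (L + 1) ^ K := card_tail_le L K
  have hcls_le : ∀ r, ((cls r).card : ℝ) ≤ (2 : ℝ) ^ L / (3 * p) + ρ ^ L * (2 : ℝ) ^ L := by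
    intro r
    have h := hρ (r : ZMod (3 * p))
    rw [abs_le] at h
    linarith [h.2]
  have h1 : (Wn.card : ℝ) ≤ (T.card : ℝ) + ((Fil.biUnion cls).card : ℝ) := by
    have := (Finset.card_le_card hsub).trans (Finset.card_union_le T (Fil.biUnion cls))
    exact_mod_cast this
  have h2 : ((Fil.biUnion cls).card : ℝ) ≤ ∑ r ∈ Fil, ((cls r).card : ℝ) := by
    have := Finset.card_biUnion_le (s := Fil) (t := cls)
    exact_mod_cast this
  have hpos : (0 : ℝ) ≤ (2 : ℝ) ^ L / (3 * p) + ρ ^ L * (2 : ℝ) ^ L := by positivity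
  have h3 : ∑ r ∈ Fil, ((cls r).card : ℝ) ≤ (2 * p : ℝ) * ((2 : ℝ) ^ L / (3 * p) + ρ ^ L * (2 : ℝ) ^ L) := by
    calc ∑ r ∈ Fil, ((cls r).card : ℝ) ≤ ∑ r ∈ Fil, ((2 : ℝ) ^ L / (3 * p) + ρ ^ L * (2 : ℝ) ^ L) :=
          Finset.sum_le_sum fun r _ => hcls_le r
      _ = (Fil.card : ℝ) * ((2 : ℝ) ^ L / (3 * p) + ρ ^ L * (2 : ℝ) ^ L) := by rw [Finset.sum_const, nsmul_eq_mul]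
      _ ≤ (2 * p : ℝ) * ((2 : ℝ) ^ L / (3 * p) + ρ ^ L * (2 : ℝ) ^ L) := by
          apply mul_le_mul_of_nonneg_right _ hpos
          exact_mod_cast hFil
  have hp0 : (0 : ℝ) < p := by exact_mod_cast hp
  have e4 : (2 * p : ℝ) * ((2 : ℝ) ^ L / (3 * p)) = 2 / 3 * (2 : ℝ) ^ L := by
    field_simp
  have hT' : (T.card : ℝ) ≤ ((K * (L + 1) ^ K : ℕ) : ℝ) := by exact_mod_cast hT
  have e5 : (2 * p : ℝ) * ((2 : ℝ) ^ L / (3 * p) + ρ ^ L * (2 : ℝ) ^ L)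
      = 2 / 3 * (2 : ℝ) ^ L + 2 * p * (ρ ^ L * (2 : ℝ) ^ L) := by rw [mul_add, e4]
  rw [e5] at h3
  linarith

end Rigid

/-- **RIGID LOSS (module U-e′, ε-form)**: for every `ε > 0` and locality radius `R` there is `L₀` such that every degenerate
`LocalOrBlind` interval of length `L ≥ L₀` (with room `a + L + 2R + 4(2p−1) ≤ n`) wins on at most `(2/3 + ε)·2^L` patterns of every
fibre (`3 ∤ p`). -/
theorem rigid_loss_far (hp : 1 ≤ p) (hp3 : p % 3 ≠ 0) (R : ℕ) {ε : ℝ} (hε : 0 < ε) :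
    ∃ L₀ : ℕ, ∀ (L : ℕ), L₀ ≤ L → ∀ (n c : ℕ) (S : ThreeStep p n) (a : ℕ),
      RegSym S a L → NearReads S R a L → a + L ≤ n →
        ∀ u : Fin n → Bool,
          ((((univ : Finset (Fin L → Bool)).filter fun P => ringWinU c S.y (place u a L P) = true).card : ℕ) : ℝ)
            ≤ (2 / 3 + ε) * (2 : ℝ) ^ L := by
  obtain ⟨ρ, hρ0, hρ1, hρ⟩ := Coset21.RungG.stub_equidist (3 * p) (by omega)
  -- the two error terms tend to zero
  have t1 : Filter.Tendsto (fun L : ℕ => (2 * p : ℝ) * ρ ^ L) Filter.atTop (nhds 0) := by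
    have h := (tendsto_pow_atTop_nhds_zero_of_lt_one hρ0 hρ1).const_mul (2 * p : ℝ)
    rw [mul_zero] at h
    exact h
  have t2 : Filter.Tendsto (fun L : ℕ => (((p + 2 * R) * (L + 1) ^ (p + 2 * R) : ℕ) : ℝ) / (2 : ℝ) ^ L)
      Filter.atTop (nhds 0) := by
    have h := (tendsto_pow_const_div_const_pow_of_one_lt (p + 2 * R) (one_lt_two : (1 : ℝ) < 2)).comp
      (Filter.tendsto_add_atTop_nat 1)
    have h2 := h.const_mul (2 * (p + 2 * R) : ℝ)
    rw [mul_zero] at h2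
    refine h2.congr' (Filter.Eventually.of_forall fun L => ?_)
    simp only [Function.comp_apply]
    push_cast
    rw [pow_succ]
    field_simp
  obtain ⟨L₁, hL₁⟩ := (Metric.tendsto_atTop.mp t1) (ε / 2) (by linarith)
  obtain ⟨L₂, hL₂⟩ := (Metric.tendsto_atTop.mp t2) (ε / 2) (by linarith)
  refine ⟨max (max L₁ L₂) (4 * p + 2 * R), ?_⟩
  intro L hL n c S a hsym hnear hn u
  have hL1 : L₁ ≤ L := le_trans (le_trans (le_max_left _ _) (le_max_left _ _)) hL
  have hL2 : L₂ ≤ L := le_trans (le_trans (le_max_right _ _) (le_max_left _ _)) hL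
  have hL4 : 4 * p + 2 * R ≤ L := le_trans (le_max_right _ _) hL
  have hρ' : ∀ t : ZMod (3 * p),
      |((((univ : Finset (Fin L → Bool)).filter fun v => ((wt v : ℕ) : ZMod (3 * p)) = t).card : ℕ) : ℝ) - (2 : ℝ) ^ L / (3 * p)|
        ≤ ρ ^ L * (2 : ℝ) ^ L := by
    intro t
    have h := hρ L t
    push_cast at h
    exact h
  have main := card_win_fibre_le_far hp hp3 c S hsym hnear hn hL4 ρ hρ0 hρ' u
  have a1 := hL₁ L hL1
  have a2 := hL₂ L hL2
  rw [Real.dist_eq, sub_zero] at a1 a2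
  have b1 : (2 * p : ℝ) * ρ ^ L < ε / 2 := lt_of_abs_lt a1
  have b2 : (((p + 2 * R) * (L + 1) ^ (p + 2 * R) : ℕ) : ℝ) / (2 : ℝ) ^ L < ε / 2 := lt_of_abs_lt a2
  have h2L : (0 : ℝ) < (2 : ℝ) ^ L := by positivity
  have b2' : (((p + 2 * R) * (L + 1) ^ (p + 2 * R) : ℕ) : ℝ) < ε / 2 * (2 : ℝ) ^ L := by
    rwa [div_lt_iff₀ h2L] at b2
  have b1' : 2 * (p : ℝ) * (ρ ^ L * (2 : ℝ) ^ L) ≤ ε / 2 * (2 : ℝ) ^ L := by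
    have : 2 * (p : ℝ) * (ρ ^ L * (2 : ℝ) ^ L) = ((2 * p : ℝ) * ρ ^ L) * (2 : ℝ) ^ L := by ring
    rw [this]
    exact mul_le_mul_of_nonneg_right b1.le h2L.le
  linarith

end RungU

end Summit.QuantumAdvantage.AdviceFreeQNC0.LocalEngine
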